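import Literature.MathematicalPhysics.QuantumFieldTheory.Balaban1983to89.B12ContinuousTransportInvarianceOn
import Literature.MathematicalPhysics.QuantumFieldTheory.Balaban1983to89.Node00.Record13SepCoPH

/-!
# NODE N09 ([Balaban1987RG1] Thm 3 p.264 + Lemma 4 p.280) KNIT TO THE STAGE-13 v1.7 `SepCoPH` RECORD OF NODE 00, ON-DOMAIN CURRENCY — the Theorem-3 member
# `smallCouplings → smallFieldInductive` at a world bound to `(datumOfRecord₁₃SepCoPH θ h).C` from [B11] Thm 1 at the record's objects, the LIFT-INVARIANCE of the
# (2.9) cut-off along the run, the SUPPORT ∕ NESTING bookkeeping on gauge-stable sets inside the maximal regular sets of the canonical-version transforms, and the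
# (0.19)-integrability — with the per-step gauge invariance of the β-layer transport `TβOfRecord₁₃ = TcanOfRecord` DISCHARGED by node00-def-K0e's theorem

T. Bałaban, *Renormalization group approach to lattice gauge field theories. I*, Commun. Math. Phys. **109** (1987) 249–301 [Balaban1987RG1] (= [I]); [B11] =
[Balaban1985Variational] (CMP 102) Thm 1 p. 279.  TRACK A (YM-PLAN §2b ∕ §2d), seat `pub-ymgap-dag-n24-c` (R134 fan-out seat of the composite node N24, strategy s2
BY-NAME KNIT; gen 8), trigger (t1″) of the N24 lineage («an N09 Stage-13 Thm-3 plug ⇒ replace the displayed binder `h09T`»); the dag-n09 lanes are closed, so the junction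
is typed here, at the in-edge the composite reads.  Key of record it serves: K1⁷ `StabilityBAtRecordR13SepCoPH` = stmt-QuantumFields-20542 (`--supports`, Literature lane).

WHY.  Through Stage 12 the Theorem-3 member of N09 at a record world was a theorem of the record's own proviso row P7 `contT` (everywhere-continuous transforms
of the (0.19) densities along `TcOfRecord`; `B12NodeKnitRecord12.thm3Member_stage12_of_hRestrict`, MODULE 2 `B12NodeKnitContinuousTransport.thm3Member_of_indATPlug_TcOfRecord`).
def-T's Stage-13 record (`Node00/Record13.lean` (κ)(λ)) carries NO transport-regularity proviso: the β-layer reads K0e's CANONICAL-VERSION transport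
`TβOfRecord₁₃ := TcanOfRecord` and the (2.9) cut-off species `chiβOfRecord₁₃ θ := chiFixed29 θ.ν θ.ε₂₉`; so the ₁₂ plug does not re-key letter for letter and every
N24 Stage-13 module displays the member as the opaque world-level binder `h09T : ∀ P, (leavesP w P).smallCouplings → (leavesP w P).smallFieldInductive`.  dag-n09-a's
MODULE 5 `B12ContinuousTransportInvarianceOn.thm3Member_of_indATPlug_of_stepsOn` is the stage-free ON-DOMAIN engine (any transport `T'`, any χ family, bookkeeping
sets `D j`); K0e's `CanonicalTransportOfRecord` §5 proved exactly its per-step input for `TcanOfRecord`: the canonical-version transform of an integrable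
lift-invariant density is gauge invariant AT EVERY POINT of its maximal regular set `regSetOfRecord` (`TcanOfRecord_gaugeAct_of_mem_regSet`).  THIS FILE composes
the two at the v1.7 record: §0 the two faces the engine reads (`flow = genFlow β₁₃ g₀`, `IndAss k ↔ IndAOfRecordT (TβOfRecord₁₃) (chiβOfRecord₁₃ θ) εbg β₁₃ …` — `rfl` ∕
`Iff.rfl` on def-T's `coreOfRecord₁₃CoPH`); §1 the per-step property ON any `D ⊆ regSetOfRecord` (K0e §5, one line); §2 the member ∕ N09 at `(w, P)` for a world
bound to the Stage-13 construction, the (2.9) cut-off's flow-blindness by `rfl` (`chiFixed29_flowBlind`); §3 the same with the bookkeeping sets CHOSEN as the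
maximal regular sets of the previous step's transform (`D 0 := univ`, `D (i+1) := regSetOfRecord K i ρ_i`), where the subset clause is `rfl`.
So «WHICH INPUT BLOCKS N09 AT STAGE 13», kernel form = §3's hypothesis list: (M1) LIFT-INVARIANCE of `χ^{(2.9)}_j` along the run (coarse-gauge covariance of the
minimiser selection `Uk` behind the critical configuration `V^{(k)}` — node00-def-B ∕ K0c species; NOT in the tree); (F7a) the SUPPORT clause «`χ^{(2.9)}_{i+1} = 0`
off `regSetOfRecord K i ρ_i`» and (F7b) the NESTING clause «`Ū^{i+1}(U_k V) ∈ regSetOfRecord K i ρ_i` for `V ∈ domAlt_k`» (print: the cut-offs restrict the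
variables to the small-field region where `A_{i+1} = log 𝐍_i⁻¹ T_i(ρ_i)` is analytic, [I] p. 256 l. 6, (2.1) p. 265, (2.10) p. 267, p. 259 ∕ (1.2) p. 260 — K0e's located
faithfulness debt F7 «`domAlt ⊆ regSet` at the β-reads», now in the weaker support ∕ nesting currency); (I19) integrability of the (0.19) densities met (K0e:
measurability of `χ^{(2.9)}` needs the (H-U) measurable minimiser selection); and [B11] Thm 1's three binders `h11 ∕ hres ∕ huniq` (N07's content).  NOTHING ELSE:
no continuity proviso, no composition clause, no χ-locality hypothesis, no invariance hypothesis on the actions.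
A NEW importing module (imports dag-n09-a MODULE 5 + def-T `Node00/Record13SepCoPH`).  THEOREMS ONLY, def-free, sorry-free, standard axioms.

WHAT THIS FILE PROVES (9 theorems).  §0 `flow_stage13SepCoPH`, `indAss_stage13SepCoPH_iff`.  §1 `stepOn_TβOfRecord₁₃_of_subset_regSet`.  §2 `thm3Member_stage13SepCoPH_of_stepsOn`,
`b12_main_stage13SepCoPH_of_leaf_of_stepsOn`, `b12_main_stage13SepCoPH_iff_leaf_of_stepsOn`.  §3 `thm3Member_stage13SepCoPH_of_regSets`, `b12_main_stage13SepCoPH_of_leaf_of_regSets`,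
`thm3Member_forall_stage13SepCoPH_of_regSets` (the `∀ P` form = N24's binder `h09T` at `hC`).

HONEST FRAMING: composition BY NAME (dag-n09-a's engine, K0e's canonical-transport theorem, def-T's faces); count-neutral kernel bookkeeping; (M1), (F7a), (F7b),
(I19) and the [B11] inputs are DISPLAYED hypotheses, located in print, none asserted; NO estimate of Bałaban's is proved; N09 NOT discharged; conjunct 1 (Lemma 4,
the leaf `b12`) untouched; K0⁷ ∕ K1⁷ NOT closed; one finite four-torus programme at fixed `ε = L^{−K}` per run — NOT ℝ⁴, NOT infinite volume, NOT OS, NOT a mass gap, NOT Clay.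
-/

noncomputable section

namespace Literature.MathematicalPhysics.QuantumFieldTheory.Balaban1983to89.B12NodeKnitRecord13SepCoPH

open MeasureTheory Set
open DagBinding Node00 T4Continuum
open FlowStep (HBeta prefixOf RGEqH)
open FlowStepRuns (genSeq genFlow)
open T4FlagMemory (extd)
open B12Eq019ActionBody (integrand)
open B12RTGaugeInvariance254 (LiftInvariant)
open GaugeField (GaugeInvariant gaugeAct)
open B12NodeKnitRecord8 (b12_main_of_leaf_of_thm3Member b12_main_iff_leaf_of_thm3Member)
open B12ContinuousTransportInvarianceOn (thm3Member_of_indATPlug_of_stepsOn)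

variable (F : T4Family) (N : ℕ) [NeZero N]

/-! ## §0. The two faces of the Stage-13 v1.7 `SepCoPH` construction N09 reads (`rfl` ∕ `Iff.rfl`) -/

/-- FACE flow AT STAGE 13 (v1.7 `SepCoPH`): every run's flow is generated FORWARD by (0.20) with the Stage-13 β of record `betaOfRecord₁₃ θ` (over `TβOfRecord₁₃ = TcanOfRecord`
and the (2.9) species) — `T4DatumAssembly.flow_datumOfTower` at def-T's `coreOfRecord₁₃CoPH θ` (`rfl`). [cite: Balaban1987RG1, (0.17)–(0.20) pp.255–256 (bookkeeping)] -/
theorem flow_stage13SepCoPH (θ : Stage13HParams F N) (h : θ.Provisos₁₃SepCoPH F N) (p : B12.RunParams) :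
    ((datumOfRecord₁₃SepCoPH F N θ h).C p).flow = genFlow (betaOfRecord₁₃ F N θ.toStage13Params) p.g0 := rfl

/-- FACE `IndAss` AT STAGE 13 (v1.7 `SepCoPH`): the clause IS node00-def-B's transport-generic `IndAOfRecordT` AT THE CANONICAL-VERSION TRANSPORT `TβOfRecord₁₃` AND THE (2.9) CUT-OFF
`chiβOfRecord₁₃ θ`, read at the generated history `genSeq β₁₃ g₀` (= `gOfRecord₁₃ θ p`) and the record's own objects — def-T's `coreOfRecord₁₃CoPH` field (`Iff.rfl`; `actionSide_stage13SepCoPH`).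
[cite: Balaban1987RG1, (1.1)–(1.6) pp.260–261, (2.9) p.266 and Thm 3 p.264 (bookkeeping)] -/
theorem indAss_stage13SepCoPH_iff (θ : Stage13HParams F N) (h : θ.Provisos₁₃SepCoPH F N) (p : B12.RunParams) (k : ℕ) :
    ((datumOfRecord₁₃SepCoPH F N θ h).C p).IndAss k ↔
      IndAOfRecordT F N (TβOfRecord₁₃ F N) (chiβOfRecord₁₃ F N θ.toStage13Params) θ.εbg (betaOfRecord₁₃ F N θ.toStage13Params) p k
        (prefixOf (genSeq (betaOfRecord₁₃ F N θ.toStage13Params) p.g0) k) (domAltOfRecord F N θ.ν p.K k)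
        (effActionOfRecordT F N (TβOfRecord₁₃ F N) (chiβOfRecord₁₃ F N θ.toStage13Params) (betaOfRecord₁₃ F N θ.toStage13Params) p k)
        (wilsonBGOfRecord F N θ.εbg p k)
        (EkOfRecordT F N (TβOfRecord₁₃ F N) (chiβOfRecord₁₃ F N θ.toStage13Params) θ.εbg (betaOfRecord₁₃ F N θ.toStage13Params) p k) := Iff.rfl

/-! ## §1. The per-step property of the canonical-version transport ON any set inside the maximal regular set (node00-def-K0e `CanonicalTransportOfRecord` §5) -/

/-- **THE ON-SET PER-STEP PROPERTY OF `TβOfRecord₁₃ = TcanOfRecord`** in the shape dag-n09-a's engine reads: for `j < K`, an integrable density `ρ` at step `j` and any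
bookkeeping set `D ⊆ regSetOfRecord K j ρ`, IF `ρ` is lift-invariant THEN its canonical-version transform is gauge invariant at every point of `D` — K0e's
`TcanOfRecord_gaugeAct_of_mem_regSet` (a.e. invariance of the transform of record + continuity of the canonical version on its open gauge-stable maximal regular set).
NO continuity proviso. [cite: Balaban1987RG1, (0.13) p.254 and p.263] -/
theorem stepOn_TβOfRecord₁₃_of_subset_regSet {K j : ℕ} (hj : j < K) (ρ : Density (F.P K) j (SU N))
    (hint : Integrable ρ (fieldMeasure (F.P K) j (SU N))) {D : Set (GaugeField (F.P K) (j + 1) (SU N))} (hD : D ⊆ regSetOfRecord F N K j ρ) :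
    LiftInvariant ρ → ∀ (v : GaugeTransf (F.P K) (j + 1) (SU N)) (V : GaugeField (F.P K) (j + 1) (SU N)), V ∈ D →
      TβOfRecord₁₃ F N K j ρ (gaugeAct v V) = TβOfRecord₁₃ F N K j ρ V :=
  fun hlift v _ hV => TcanOfRecord_gaugeAct_of_mem_regSet hj hint hlift v (hD hV)

/-! ## §2. The Theorem-3 member ∕ N09 at `(w, P)` for a world bound to the Stage-13 construction, bookkeeping sets `D j` abstract -/

section Stage13

variable {F N}

/-- **THE THEOREM-3 MEMBER OF N09 AT `(w, P)` FOR A WORLD BOUND TO THE STAGE-13 v1.7 CONSTRUCTION, ON-DOMAIN CURRENCY**: for `w.C = (datumOfRecord₁₃SepCoPH θ h).C` and a run `P`,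
given bookkeeping sets `D j` of step-`j` fields, `smallCouplings → smallFieldInductive` follows from — (M1) the LIFT-INVARIANCE of the (2.9) cut-off `χ^{(2.9)}_j` along the
run (`j < K`); the SUPPORT clause «`χ^{(2.9)}_j = 0` off `D j`»; (I19) the integrability of the (0.19) densities met `ρ_j = betaInputOfRecord (TβOfRecord₁₃) (chiβOfRecord₁₃ θ) K g j`;
the inclusion `D (j+1) ⊆ regSetOfRecord K j ρ_j` (the new fields the cut-off lets through lie in the maximal regular set of the transform they are fed to — print's «χ
restricts the integral to small fluctuation fields», where `A_{j+1}` is analytic); [B11] Thm 1's three binders on the record's domains `domAltOfRecord θ.ν` ((1.1)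
solvability + uniqueness, `HRestrict`, intermediate uniqueness); and the NESTING «`Ū^j(U_k V) ∈ D j`».  dag-n09-a's `thm3Member_of_indATPlug_of_stepsOn` at `T' := TβOfRecord₁₃`,
`χ := chiβOfRecord₁₃ θ`, `ε := θ.εbg`, `β := betaOfRecord₁₃ θ`, `dom := domAltOfRecord θ.ν P.K`, fed by §0's faces, the cut-off's flow-blindness (`rfl`) and §1.  NO continuity
proviso, NO composition ∕ invariance ∕ χ-locality hypothesis.  CONDITIONAL on every displayed hypothesis; nothing of Bałaban asserted; N09 NOT discharged.
[cite: Balaban1987RG1, Thm 3 p.264, (1.1)–(1.3) p.260, (0.13) p.254, p.256, p.259, p.263, (2.1) p.265, (2.9)–(2.10) pp.266–267, (2.16) p.269; Balaban1985Variational, Thm 1 (8)–(10) p.279] -/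
theorem thm3Member_stage13SepCoPH_of_stepsOn (θ : Stage13HParams F N) (h : θ.Provisos₁₃SepCoPH F N) {w : WorldP}
    (hC : w.C = (datumOfRecord₁₃SepCoPH F N θ h).C) (P : B12.RunParams) (D : (j : ℕ) → Set (GaugeField (F.P P.K) j (SU N)))
    (hχinv : ∀ j < P.K, LiftInvariant (chiβOfRecord₁₃ F N θ.toStage13Params P.K (gOfRecord₁₃ F N θ.toStage13Params P) j))
    (hχD : ∀ j < P.K, ∀ U, U ∉ D j → chiβOfRecord₁₃ F N θ.toStage13Params P.K (gOfRecord₁₃ F N θ.toStage13Params P) j U = 0)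
    (hint : ∀ j < P.K, Integrable (betaInputOfRecord F N (TβOfRecord₁₃ F N) (chiβOfRecord₁₃ F N θ.toStage13Params) P.K (gOfRecord₁₃ F N θ.toStage13Params P) j)
      (fieldMeasure (F.P P.K) j (SU N)))
    (hreg : ∀ j < P.K, D (j + 1) ⊆ regSetOfRecord F N P.K j
      (betaInputOfRecord F N (TβOfRecord₁₃ F N) (chiβOfRecord₁₃ F N θ.toStage13Params) P.K (gOfRecord₁₃ F N θ.toStage13Params P) j))
    (h11 : ∀ k, k ≤ P.K → ∀ V ∈ domAltOfRecord F N θ.ν P.K k, UkExists F N P.K k θ.εbg V ∧ UniqueUkOrbit F N P.K k θ.εbg V)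
    (hres : ∀ k, k ≤ P.K → HRestrict F N θ.εbg P.K k (domAltOfRecord F N θ.ν P.K k))
    (huniq : ∀ k, k ≤ P.K → ∀ V ∈ domAltOfRecord F N θ.ν P.K k, ∀ j < k,
      UniqueUkOrbit F N P.K (j + 1) θ.εbg (Averaging.iter (avOfRecord F N P.K) (j + 1) (Uk F N P.K k θ.εbg V)))
    (hnest : ∀ k, k ≤ P.K → ∀ V ∈ domAltOfRecord F N θ.ν P.K k, ∀ j < k, Averaging.iter (avOfRecord F N P.K) j (Uk F N P.K k θ.εbg V) ∈ D j) :
    (leavesP w P).smallCouplings → (leavesP w P).smallFieldInductive :=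
  thm3Member_of_indATPlug_of_stepsOn (TβOfRecord₁₃ F N) (chiβOfRecord₁₃ F N θ.toStage13Params) θ.εbg (betaOfRecord₁₃ F N θ.toStage13Params)
    (fun k => domAltOfRecord F N θ.ν P.K k) D
    (by rw [hC]; exact flow_stage13SepCoPH F N θ h P) (fun k _ => by rw [hC]; exact indAss_stage13SepCoPH_iff F N θ h P k)
    (fun _ _ _ _ => rfl) hχinv hχD (fun j hj => stepOn_TβOfRecord₁₃_of_subset_regSet F N hj _ (hint j hj) (hreg j hj)) h11 hres huniq hnest

/-- **N09 AT `(w, P)`, Stage-13 v1.7 construction, ON-DOMAIN CURRENCY**: its own leaf `b12` ([I] Lemma 4) + the inputs of `thm3Member_stage13SepCoPH_of_stepsOn` ⇒ `Dag.B12_main (leavesP w P)`.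
CONDITIONAL; N09 NOT discharged. [cite: Balaban1987RG1, Lemma 4 (3.53) p.280, Thm 3 p.264 and (1.1)–(1.3) p.260; Balaban1985Variational, Thm 1 p.279] -/
theorem b12_main_stage13SepCoPH_of_leaf_of_stepsOn (θ : Stage13HParams F N) (h : θ.Provisos₁₃SepCoPH F N) {w : WorldP}
    (hC : w.C = (datumOfRecord₁₃SepCoPH F N θ h).C) (P : B12.RunParams) (h12 : (leavesP w P).b12) (D : (j : ℕ) → Set (GaugeField (F.P P.K) j (SU N)))
    (hχinv : ∀ j < P.K, LiftInvariant (chiβOfRecord₁₃ F N θ.toStage13Params P.K (gOfRecord₁₃ F N θ.toStage13Params P) j))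
    (hχD : ∀ j < P.K, ∀ U, U ∉ D j → chiβOfRecord₁₃ F N θ.toStage13Params P.K (gOfRecord₁₃ F N θ.toStage13Params P) j U = 0)
    (hint : ∀ j < P.K, Integrable (betaInputOfRecord F N (TβOfRecord₁₃ F N) (chiβOfRecord₁₃ F N θ.toStage13Params) P.K (gOfRecord₁₃ F N θ.toStage13Params P) j)
      (fieldMeasure (F.P P.K) j (SU N)))
    (hreg : ∀ j < P.K, D (j + 1) ⊆ regSetOfRecord F N P.K j
      (betaInputOfRecord F N (TβOfRecord₁₃ F N) (chiβOfRecord₁₃ F N θ.toStage13Params) P.K (gOfRecord₁₃ F N θ.toStage13Params P) j))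
    (h11 : ∀ k, k ≤ P.K → ∀ V ∈ domAltOfRecord F N θ.ν P.K k, UkExists F N P.K k θ.εbg V ∧ UniqueUkOrbit F N P.K k θ.εbg V)
    (hres : ∀ k, k ≤ P.K → HRestrict F N θ.εbg P.K k (domAltOfRecord F N θ.ν P.K k))
    (huniq : ∀ k, k ≤ P.K → ∀ V ∈ domAltOfRecord F N θ.ν P.K k, ∀ j < k,
      UniqueUkOrbit F N P.K (j + 1) θ.εbg (Averaging.iter (avOfRecord F N P.K) (j + 1) (Uk F N P.K k θ.εbg V)))
    (hnest : ∀ k, k ≤ P.K → ∀ V ∈ domAltOfRecord F N θ.ν P.K k, ∀ j < k, Averaging.iter (avOfRecord F N P.K) j (Uk F N P.K k θ.εbg V) ∈ D j) :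
    Dag.B12_main (leavesP w P) :=
  b12_main_of_leaf_of_thm3Member h12 (thm3Member_stage13SepCoPH_of_stepsOn θ h hC P D hχinv hχD hint hreg h11 hres huniq hnest)

/-- **N09 AT `(w, P)`, Stage-13 v1.7 construction, IS «in-edges → its own leaf `b12`»** given the on-domain inputs. [cite: Balaban1987RG1, Lemma 4 (3.53) p.280 and Thm 3 p.264 (bookkeeping)] -/
theorem b12_main_stage13SepCoPH_iff_leaf_of_stepsOn (θ : Stage13HParams F N) (h : θ.Provisos₁₃SepCoPH F N) {w : WorldP}
    (hC : w.C = (datumOfRecord₁₃SepCoPH F N θ h).C) (P : B12.RunParams) (D : (j : ℕ) → Set (GaugeField (F.P P.K) j (SU N)))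
    (hχinv : ∀ j < P.K, LiftInvariant (chiβOfRecord₁₃ F N θ.toStage13Params P.K (gOfRecord₁₃ F N θ.toStage13Params P) j))
    (hχD : ∀ j < P.K, ∀ U, U ∉ D j → chiβOfRecord₁₃ F N θ.toStage13Params P.K (gOfRecord₁₃ F N θ.toStage13Params P) j U = 0)
    (hint : ∀ j < P.K, Integrable (betaInputOfRecord F N (TβOfRecord₁₃ F N) (chiβOfRecord₁₃ F N θ.toStage13Params) P.K (gOfRecord₁₃ F N θ.toStage13Params P) j)
      (fieldMeasure (F.P P.K) j (SU N)))
    (hreg : ∀ j < P.K, D (j + 1) ⊆ regSetOfRecord F N P.K j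
      (betaInputOfRecord F N (TβOfRecord₁₃ F N) (chiβOfRecord₁₃ F N θ.toStage13Params) P.K (gOfRecord₁₃ F N θ.toStage13Params P) j))
    (h11 : ∀ k, k ≤ P.K → ∀ V ∈ domAltOfRecord F N θ.ν P.K k, UkExists F N P.K k θ.εbg V ∧ UniqueUkOrbit F N P.K k θ.εbg V)
    (hres : ∀ k, k ≤ P.K → HRestrict F N θ.εbg P.K k (domAltOfRecord F N θ.ν P.K k))
    (huniq : ∀ k, k ≤ P.K → ∀ V ∈ domAltOfRecord F N θ.ν P.K k, ∀ j < k,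
      UniqueUkOrbit F N P.K (j + 1) θ.εbg (Averaging.iter (avOfRecord F N P.K) (j + 1) (Uk F N P.K k θ.εbg V)))
    (hnest : ∀ k, k ≤ P.K → ∀ V ∈ domAltOfRecord F N θ.ν P.K k, ∀ j < k, Averaging.iter (avOfRecord F N P.K) j (Uk F N P.K k θ.εbg V) ∈ D j) :
    Dag.B12_main (leavesP w P) ↔
      ((leavesP w P).b4 → (leavesP w P).b5 → (leavesP w P).b6 → (leavesP w P).b7 → (leavesP w P).b8 → (leavesP w P).b9 →
        (leavesP w P).b10 → (leavesP w P).b11 → (leavesP w P).b12) :=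
  b12_main_iff_leaf_of_thm3Member (thm3Member_stage13SepCoPH_of_stepsOn θ h hC P D hχinv hχD hint hreg h11 hres huniq hnest)

end Stage13

/-! ## §3. The bookkeeping sets CHOSEN: `D 0 := univ`, `D (i+1) :=` the maximal regular set of the step-`i` canonical-version transform — the located form -/

section RegSets

variable {F N}

/-- **THE THEOREM-3 MEMBER AT THE STAGE-13 v1.7 CONSTRUCTION, LOCATED FORM** — §2 with the bookkeeping sets chosen as `D 0 := univ`, `D (i+1) := regSetOfRecord K i ρ_i` (the
maximal open gauge-stable set on which the canonical version of the transform of `ρ_i = betaInputOfRecord (TβOfRecord₁₃) (chiβOfRecord₁₃ θ) K g i` is continuous), so that the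
inclusion clause of §2 is `rfl`.  What stays displayed, each located in print: (M1) LIFT-INVARIANCE of `χ^{(2.9)}_j` along the run ([I] (2.9) p.266 is built from `V·V^{(k)}(V̄)⁻¹`,
covariant under coarse gauge transformations iff the minimiser selection `U_{k+1}` is — node00-def-B ∕ K0c species, NOT in the tree); (F7a) SUPPORT «`χ^{(2.9)}_{i+1}(U) = 0` unless
`U ∈ regSetOfRecord K i ρ_i`» and (F7b) NESTING «`Ū^{i+1}(U_k V) ∈ regSetOfRecord K i ρ_i` for `V ∈ domAlt_k`, `i + 1 < k ≤ K`» ([I] p.256 l.6, (2.1) p.265, (2.10) p.267,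
p.259 ∕ (1.2) p.260: the cut-off and the averaged minimisers sit in the small-field region where `A_{i+1}` is analytic — K0e's faithfulness debt F7 in support ∕ nesting
currency); (I19) integrability of the (0.19) densities met; [B11] Thm 1's `h11 ∕ hres ∕ huniq`.  CONDITIONAL; nothing of Bałaban asserted; N09 NOT discharged.
[cite: Balaban1987RG1, Thm 3 p.264, (1.1)–(1.3) p.260, (0.13) p.254, p.256, p.259, p.263, (2.1) p.265, (2.9)–(2.10) pp.266–267; Balaban1985Variational, Thm 1 (8)–(10) p.279] -/
theorem thm3Member_stage13SepCoPH_of_regSets (θ : Stage13HParams F N) (h : θ.Provisos₁₃SepCoPH F N) {w : WorldP}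
    (hC : w.C = (datumOfRecord₁₃SepCoPH F N θ h).C) (P : B12.RunParams)
    (hχinv : ∀ j < P.K, LiftInvariant (chiβOfRecord₁₃ F N θ.toStage13Params P.K (gOfRecord₁₃ F N θ.toStage13Params P) j))
    (hχreg : ∀ i, i + 1 < P.K → ∀ U, U ∉ regSetOfRecord F N P.K i
        (betaInputOfRecord F N (TβOfRecord₁₃ F N) (chiβOfRecord₁₃ F N θ.toStage13Params) P.K (gOfRecord₁₃ F N θ.toStage13Params P) i) →
      chiβOfRecord₁₃ F N θ.toStage13Params P.K (gOfRecord₁₃ F N θ.toStage13Params P) (i + 1) U = 0)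
    (hint : ∀ j < P.K, Integrable (betaInputOfRecord F N (TβOfRecord₁₃ F N) (chiβOfRecord₁₃ F N θ.toStage13Params) P.K (gOfRecord₁₃ F N θ.toStage13Params P) j)
      (fieldMeasure (F.P P.K) j (SU N)))
    (h11 : ∀ k, k ≤ P.K → ∀ V ∈ domAltOfRecord F N θ.ν P.K k, UkExists F N P.K k θ.εbg V ∧ UniqueUkOrbit F N P.K k θ.εbg V)
    (hres : ∀ k, k ≤ P.K → HRestrict F N θ.εbg P.K k (domAltOfRecord F N θ.ν P.K k))
    (huniq : ∀ k, k ≤ P.K → ∀ V ∈ domAltOfRecord F N θ.ν P.K k, ∀ j < k,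
      UniqueUkOrbit F N P.K (j + 1) θ.εbg (Averaging.iter (avOfRecord F N P.K) (j + 1) (Uk F N P.K k θ.εbg V)))
    (hnestreg : ∀ k, k ≤ P.K → ∀ V ∈ domAltOfRecord F N θ.ν P.K k, ∀ i, i + 1 < k →
      Averaging.iter (avOfRecord F N P.K) (i + 1) (Uk F N P.K k θ.εbg V) ∈ regSetOfRecord F N P.K i
        (betaInputOfRecord F N (TβOfRecord₁₃ F N) (chiβOfRecord₁₃ F N θ.toStage13Params) P.K (gOfRecord₁₃ F N θ.toStage13Params P) i)) :
    (leavesP w P).smallCouplings → (leavesP w P).smallFieldInductive := by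
  refine thm3Member_stage13SepCoPH_of_stepsOn θ h hC P
    (fun j => Nat.rec (motive := fun j => Set (GaugeField (F.P P.K) j (SU N))) Set.univ
      (fun i _ => regSetOfRecord F N P.K i
        (betaInputOfRecord F N (TβOfRecord₁₃ F N) (chiβOfRecord₁₃ F N θ.toStage13Params) P.K (gOfRecord₁₃ F N θ.toStage13Params P) i)) j)
    hχinv ?_ hint (fun j _ => subset_rfl) h11 hres huniq ?_
  · intro j hj U hU
    cases j with
    | zero => exact absurd (Set.mem_univ U) hU
    | succ i => exact hχreg i hj U hU
  · intro k hk V hV j hjk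
    cases j with
    | zero => exact Set.mem_univ _
    | succ i => exact hnestreg k hk V hV i hjk

/-- **N09 AT `(w, P)`, Stage-13 v1.7 construction, LOCATED FORM**: own leaf `b12` + §3's inputs ⇒ `Dag.B12_main (leavesP w P)`.  CONDITIONAL; N09 NOT discharged.
[cite: Balaban1987RG1, Lemma 4 (3.53) p.280, Thm 3 p.264 and (1.1)–(1.3) p.260; Balaban1985Variational, Thm 1 p.279] -/
theorem b12_main_stage13SepCoPH_of_leaf_of_regSets (θ : Stage13HParams F N) (h : θ.Provisos₁₃SepCoPH F N) {w : WorldP}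
    (hC : w.C = (datumOfRecord₁₃SepCoPH F N θ h).C) (P : B12.RunParams) (h12 : (leavesP w P).b12)
    (hχinv : ∀ j < P.K, LiftInvariant (chiβOfRecord₁₃ F N θ.toStage13Params P.K (gOfRecord₁₃ F N θ.toStage13Params P) j))
    (hχreg : ∀ i, i + 1 < P.K → ∀ U, U ∉ regSetOfRecord F N P.K i
        (betaInputOfRecord F N (TβOfRecord₁₃ F N) (chiβOfRecord₁₃ F N θ.toStage13Params) P.K (gOfRecord₁₃ F N θ.toStage13Params P) i) →
      chiβOfRecord₁₃ F N θ.toStage13Params P.K (gOfRecord₁₃ F N θ.toStage13Params P) (i + 1) U = 0)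
    (hint : ∀ j < P.K, Integrable (betaInputOfRecord F N (TβOfRecord₁₃ F N) (chiβOfRecord₁₃ F N θ.toStage13Params) P.K (gOfRecord₁₃ F N θ.toStage13Params P) j)
      (fieldMeasure (F.P P.K) j (SU N)))
    (h11 : ∀ k, k ≤ P.K → ∀ V ∈ domAltOfRecord F N θ.ν P.K k, UkExists F N P.K k θ.εbg V ∧ UniqueUkOrbit F N P.K k θ.εbg V)
    (hres : ∀ k, k ≤ P.K → HRestrict F N θ.εbg P.K k (domAltOfRecord F N θ.ν P.K k))
    (huniq : ∀ k, k ≤ P.K → ∀ V ∈ domAltOfRecord F N θ.ν P.K k, ∀ j < k,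
      UniqueUkOrbit F N P.K (j + 1) θ.εbg (Averaging.iter (avOfRecord F N P.K) (j + 1) (Uk F N P.K k θ.εbg V)))
    (hnestreg : ∀ k, k ≤ P.K → ∀ V ∈ domAltOfRecord F N θ.ν P.K k, ∀ i, i + 1 < k →
      Averaging.iter (avOfRecord F N P.K) (i + 1) (Uk F N P.K k θ.εbg V) ∈ regSetOfRecord F N P.K i
        (betaInputOfRecord F N (TβOfRecord₁₃ F N) (chiβOfRecord₁₃ F N θ.toStage13Params) P.K (gOfRecord₁₃ F N θ.toStage13Params P) i)) :
    Dag.B12_main (leavesP w P) :=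
  b12_main_of_leaf_of_thm3Member h12 (thm3Member_stage13SepCoPH_of_regSets θ h hC P hχinv hχreg hint h11 hres huniq hnestreg)

/-- **THE `∀ P` FORM = N24's DISPLAYED BINDER `h09T` AT A WORLD BOUND TO THE STAGE-13 v1.7 CONSTRUCTION** (every N24 Stage-13 door ∕ rung form takes
`h09T : ∀ P, (leavesP w P).smallCouplings → (leavesP w P).smallFieldInductive` at `hC : w.C = (datumOfRecord₁₃SepCoPH θ hP).C`): it is supplied run by run by §3 from the located
inputs (M1), (F7a), (F7b), (I19) and [B11] Thm 1's three binders.  CONDITIONAL; nothing of Bałaban asserted; N09 NOT discharged; K1⁷ NOT closed.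
[cite: Balaban1987RG1, Thm 3 p.264, (1.1)–(1.3) p.260, (2.9)–(2.10) pp.266–267; Balaban1985Variational, Thm 1 (8)–(10) p.279] -/
theorem thm3Member_forall_stage13SepCoPH_of_regSets (θ : Stage13HParams F N) (h : θ.Provisos₁₃SepCoPH F N) {w : WorldP}
    (hC : w.C = (datumOfRecord₁₃SepCoPH F N θ h).C)
    (hχinv : ∀ (P : B12.RunParams), ∀ j < P.K, LiftInvariant (chiβOfRecord₁₃ F N θ.toStage13Params P.K (gOfRecord₁₃ F N θ.toStage13Params P) j))
    (hχreg : ∀ (P : B12.RunParams) (i : ℕ), i + 1 < P.K → ∀ U, U ∉ regSetOfRecord F N P.K i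
        (betaInputOfRecord F N (TβOfRecord₁₃ F N) (chiβOfRecord₁₃ F N θ.toStage13Params) P.K (gOfRecord₁₃ F N θ.toStage13Params P) i) →
      chiβOfRecord₁₃ F N θ.toStage13Params P.K (gOfRecord₁₃ F N θ.toStage13Params P) (i + 1) U = 0)
    (hint : ∀ (P : B12.RunParams), ∀ j < P.K, Integrable (betaInputOfRecord F N (TβOfRecord₁₃ F N) (chiβOfRecord₁₃ F N θ.toStage13Params) P.K (gOfRecord₁₃ F N θ.toStage13Params P) j)
      (fieldMeasure (F.P P.K) j (SU N)))
    (h11 : ∀ (P : B12.RunParams) (k : ℕ), k ≤ P.K → ∀ V ∈ domAltOfRecord F N θ.ν P.K k, UkExists F N P.K k θ.εbg V ∧ UniqueUkOrbit F N P.K k θ.εbg V)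
    (hres : ∀ (P : B12.RunParams) (k : ℕ), k ≤ P.K → HRestrict F N θ.εbg P.K k (domAltOfRecord F N θ.ν P.K k))
    (huniq : ∀ (P : B12.RunParams) (k : ℕ), k ≤ P.K → ∀ V ∈ domAltOfRecord F N θ.ν P.K k, ∀ j < k,
      UniqueUkOrbit F N P.K (j + 1) θ.εbg (Averaging.iter (avOfRecord F N P.K) (j + 1) (Uk F N P.K k θ.εbg V)))
    (hnestreg : ∀ (P : B12.RunParams) (k : ℕ), k ≤ P.K → ∀ V ∈ domAltOfRecord F N θ.ν P.K k, ∀ i, i + 1 < k →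
      Averaging.iter (avOfRecord F N P.K) (i + 1) (Uk F N P.K k θ.εbg V) ∈ regSetOfRecord F N P.K i
        (betaInputOfRecord F N (TβOfRecord₁₃ F N) (chiβOfRecord₁₃ F N θ.toStage13Params) P.K (gOfRecord₁₃ F N θ.toStage13Params P) i)) :
    ∀ P : B12.RunParams, (leavesP w P).smallCouplings → (leavesP w P).smallFieldInductive :=
  fun P => thm3Member_stage13SepCoPH_of_regSets θ h hC P (hχinv P) (hχreg P) (hint P) (h11 P) (hres P) (huniq P) (hnestreg P)

end RegSets

/-! ## §4. (v1.1) (I19) FROM (H-U): over the canonical-version transport every (0.19) density met at a step `k < K` is integrable as soon as the cut-offs are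
MEASURABLE and `[0,1]`-valued — for the (2.9) cut-off of record: as soon as the minimiser selection `W ↦ U_{k+1}(W)` is measurable (K0e `measurable_chiFix29OfRecord_of`) -/

section Measurable

open B12Eq019ActionBody (integrand_apply nextAction_apply)
open B12NodeKnitContinuousTransport (measurable_gfOfRecord gfOfRecord_nonneg integrable_of_bounded_measurable measurable_integrand abs_integrand_le)

/-- `exp (log x) ≤ |x| + 1` (elementary; MODULE 2's private helper re-proved for this file). [folklore] -/
private theorem exp_log_le_abs_add_one (x : ℝ) : Real.exp (Real.log x) ≤ |x| + 1 := by
  by_cases hx : x = 0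
  · rw [hx, Real.log_zero, Real.exp_zero]; simp
  · rw [Real.exp_log_eq_abs hx]; linarith [abs_nonneg x]

/-- **(v1.1) INTEGRABILITY OF EVERY (0.19) DENSITY MET OVER THE CANONICAL-VERSION TRANSPORT FROM MEASURABILITY OF THE CUT-OFFS** (any χ family, measurable and
`[0,1]`-valued at the steps `k < K` of the `K`-th torus): `χ_k·exp[−GF_k∕g_k² + A_k]` is integrable for `dU` — at `k = 0` it is measurable and bounded by `1`
(`A_0 = −(1∕g_0²)A^η ≤ 0`); at `k + 1 < K` it is a.e.-measurable and DOMINATED by `|𝐍_k⁻¹|·|TcanOfRecord K k ρ_k| + 1` (`A_{k+1} = log(𝐍_k⁻¹·T_k ρ_k)`,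
`exp (log x) ≤ |x| + 1`), which is integrable by K0e's `integrable_TcanOfRecord` and the induction hypothesis.  MODULE 2's `integrable_integrand_of_continuousTransport`
without the continuity of the images (which `TcanOfRecord` does not have off `regSetOfRecord`).  [cite: Balaban1987RG1, (0.13) p.254, (0.17)–(0.19) p.255] -/
theorem integrable_betaInput_TcanOfRecord_of_measurable (χ : (K : ℕ) → (ℕ → ℝ) → (k : ℕ) → Density (F.P K) k (SU N)) (K : ℕ) (g : ℕ → ℝ)
    (hχm : ∀ k, k < K → Measurable (χ K g k)) (hχ0 : ∀ k U, 0 ≤ χ K g k U) (hχ1 : ∀ k U, χ K g k U ≤ 1) :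
    ∀ k, k < K → Integrable (integrand (χ K g k) (gfOfRecord F N K k) (g k) (effActionHT F N (TcanOfRecord F N) χ K g k)) (fieldMeasure (F.P K) k (SU N)) := by
  intro k
  induction k with
  | zero =>
    intro hk
    refine integrable_of_bounded_measurable
      (measurable_integrand (hχm 0 hk) (measurable_gfOfRecord K 0) ?_ (g 0))
      (abs_integrand_le (hχ0 0) (hχ1 0) (gfOfRecord_nonneg K 0) (g 0) (B := 1) ?_)
    · rw [effActionHT_zero]
      exact T4WilsonResponseJunction.measurable_neg_mul_wilsonAction _ _
    · intro U
      rw [effActionHT_zero]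
      refine Real.exp_le_one_iff.2 ?_
      show -(1 / g 0 ^ 2) * wilsonAction 1 U ≤ 0
      have : 0 ≤ 1 / g 0 ^ 2 * wilsonAction 1 U := mul_nonneg (one_div_nonneg.2 (sq_nonneg _)) (wilsonAction4_nonneg U)
      linarith
  | succ j ih =>
    intro hjK
    have hj : j < K := lt_trans (Nat.lt_succ_self j) hjK
    have hρ := ih hj
    have hT : Integrable (TcanOfRecord F N K j (integrand (χ K g j) (gfOfRecord F N K j) (g j) (effActionHT F N (TcanOfRecord F N) χ K g j)))
        (fieldMeasure (F.P K) (j + 1) (SU N)) := integrable_TcanOfRecord hj hρ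
    set c : ℝ := (normConstHT F N (TcanOfRecord F N) χ K g j)⁻¹ with hc
    have hdom : Integrable (fun V => |c| * |TcanOfRecord F N K j (integrand (χ K g j) (gfOfRecord F N K j) (g j)
        (effActionHT F N (TcanOfRecord F N) χ K g j)) V| + 1) (fieldMeasure (F.P K) (j + 1) (SU N)) :=
      (hT.abs.const_mul |c|).add (integrable_const 1)
    refine Integrable.mono' hdom ?_ (Filter.Eventually.of_forall fun V => ?_)
    · have hA : AEMeasurable (effActionHT F N (TcanOfRecord F N) χ K g (j + 1)) (fieldMeasure (F.P K) (j + 1) (SU N)) := by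
        rw [effActionHT_succ]
        show AEMeasurable (fun V => Real.log ((B12Eq019ActionBody.normConst (TcanOfRecord F N K j) (χ K g j) (gfOfRecord F N K j) (g j)
          (effActionHT F N (TcanOfRecord F N) χ K g j))⁻¹ * TcanOfRecord F N K j (integrand (χ K g j) (gfOfRecord F N K j) (g j)
          (effActionHT F N (TcanOfRecord F N) χ K g j)) V)) _
        exact Real.measurable_log.comp_aemeasurable (hT.aemeasurable.const_mul _)
      have hI : AEMeasurable (integrand (χ K g (j + 1)) (gfOfRecord F N K (j + 1)) (g (j + 1)) (effActionHT F N (TcanOfRecord F N) χ K g (j + 1)))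
          (fieldMeasure (F.P K) (j + 1) (SU N)) := by
        rw [B12Eq019ActionBody.integrand_eq]
        exact (hχm (j + 1) hjK).aemeasurable.mul
          (Real.measurable_exp.comp_aemeasurable (((measurable_const.mul (measurable_gfOfRecord K (j + 1))).aemeasurable).add hA))
      exact hI.aestronglyMeasurable
    · rw [Real.norm_eq_abs, integrand_apply, abs_mul, abs_of_nonneg (hχ0 (j + 1) V), Real.abs_exp, Real.exp_add]
      have h1 : Real.exp (-(1 / g (j + 1) ^ 2) * gfOfRecord F N K (j + 1) V) ≤ 1 := by
        refine Real.exp_le_one_iff.2 ?_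
        have : 0 ≤ 1 / g (j + 1) ^ 2 * gfOfRecord F N K (j + 1) V := mul_nonneg (one_div_nonneg.2 (sq_nonneg _)) (gfOfRecord_nonneg K (j + 1) V)
        linarith
      have h2 : Real.exp (effActionHT F N (TcanOfRecord F N) χ K g (j + 1) V) ≤
          |c| * |TcanOfRecord F N K j (integrand (χ K g j) (gfOfRecord F N K j) (g j) (effActionHT F N (TcanOfRecord F N) χ K g j)) V| + 1 := by
        rw [effActionHT_succ, nextAction_apply]
        refine (exp_log_le_abs_add_one _).trans ?_
        rw [abs_mul]
        exact le_rfl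
      calc χ K g (j + 1) V * (Real.exp (-(1 / g (j + 1) ^ 2) * gfOfRecord F N K (j + 1) V) *
              Real.exp (effActionHT F N (TcanOfRecord F N) χ K g (j + 1) V))
          ≤ 1 * (1 * (|c| * |TcanOfRecord F N K j (integrand (χ K g j) (gfOfRecord F N K j) (g j)
              (effActionHT F N (TcanOfRecord F N) χ K g j)) V| + 1)) := by
            refine mul_le_mul (hχ1 (j + 1) V) (mul_le_mul h1 h2 (Real.exp_pos _).le zero_le_one) ?_ zero_le_one
            exact mul_nonneg (Real.exp_pos _).le (Real.exp_pos _).le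
        _ = _ := by ring

variable {F N}

/-- **(v1.1) (I19) AT THE STAGE-13 RECORD FROM (H-U)**: along any run of a Stage-13 parameter the (0.19) densities met over `TβOfRecord₁₃ = TcanOfRecord` with the (2.9)
cut-off `chiβOfRecord₁₃ θ₀` are integrable at every step `j < K` AS SOON AS the minimiser selection `W ↦ U_{k+1}(W)` of record is MEASURABLE at the steps `k < K`
(K0e `measurable_chiFix29OfRecord_of`; `χ^{(2.9)} ∈ {0,1}`).  (H-U) = the K0c ∕ def-R measurable-selection species; DISPLAYED, not asserted. [cite: Balaban1987RG1, (0.19) p.255, (2.9) p.266] -/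
theorem integrable_betaInput_stage13_of_measurableUk (θ₀ : Stage13Params F N) (P : B12.RunParams)
    (hU : ∀ k, k < P.K → Measurable (Uk F N P.K (k + 1) θ₀.ν.εreg)) :
    ∀ j, j < P.K → Integrable (betaInputOfRecord F N (TβOfRecord₁₃ F N) (chiβOfRecord₁₃ F N θ₀) P.K (gOfRecord₁₃ F N θ₀ P) j) (fieldMeasure (F.P P.K) j (SU N)) :=
  integrable_betaInput_TcanOfRecord_of_measurable F N (chiβOfRecord₁₃ F N θ₀) P.K (gOfRecord₁₃ F N θ₀ P)
    (fun k hk => measurable_chiFix29OfRecord_of (F := F) (N := N) θ₀.ε₂₉ (hU k hk))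
    (fun k U => (chiFix29OfRecord_mem_Icc (F := F) (N := N) θ₀.ν θ₀.ε₂₉ P.K k U).1)
    (fun k U => (chiFix29OfRecord_mem_Icc (F := F) (N := N) θ₀.ν θ₀.ε₂₉ P.K k U).2)

/-- **(v1.1) THE THEOREM-3 MEMBER AT THE STAGE-13 v1.7 CONSTRUCTION, LOCATED FORM, (I19) REPLACED BY (H-U)**: §3's `thm3Member_stage13SepCoPH_of_regSets` with the integrability
binder supplied by `integrable_betaInput_stage13_of_measurableUk`.  Displayed: (M1) lift-invariance of the (2.9) cut-off, (H-U) measurability of the minimiser selection — TWO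
properties of the selection `Uk` behind `critCfgOfRecord` — (F7a) support, (F7b) nesting, [B11] Thm 1 ×3.  CONDITIONAL; nothing of Bałaban asserted; N09 NOT discharged.
[cite: Balaban1987RG1, Thm 3 p.264, (1.1)–(1.3) p.260, (0.13) p.254, (0.19) p.255, (2.9)–(2.10) pp.266–267; Balaban1985Variational, Thm 1 (8)–(10) p.279] -/
theorem thm3Member_stage13SepCoPH_of_regSets_of_measurableUk (θ : Stage13HParams F N) (h : θ.Provisos₁₃SepCoPH F N) {w : WorldP}
    (hC : w.C = (datumOfRecord₁₃SepCoPH F N θ h).C) (P : B12.RunParams)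
    (hχinv : ∀ j < P.K, LiftInvariant (chiβOfRecord₁₃ F N θ.toStage13Params P.K (gOfRecord₁₃ F N θ.toStage13Params P) j))
    (hU : ∀ k, k < P.K → Measurable (Uk F N P.K (k + 1) θ.ν.εreg))
    (hχreg : ∀ i, i + 1 < P.K → ∀ U, U ∉ regSetOfRecord F N P.K i
        (betaInputOfRecord F N (TβOfRecord₁₃ F N) (chiβOfRecord₁₃ F N θ.toStage13Params) P.K (gOfRecord₁₃ F N θ.toStage13Params P) i) →
      chiβOfRecord₁₃ F N θ.toStage13Params P.K (gOfRecord₁₃ F N θ.toStage13Params P) (i + 1) U = 0)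
    (h11 : ∀ k, k ≤ P.K → ∀ V ∈ domAltOfRecord F N θ.ν P.K k, UkExists F N P.K k θ.εbg V ∧ UniqueUkOrbit F N P.K k θ.εbg V)
    (hres : ∀ k, k ≤ P.K → HRestrict F N θ.εbg P.K k (domAltOfRecord F N θ.ν P.K k))
    (huniq : ∀ k, k ≤ P.K → ∀ V ∈ domAltOfRecord F N θ.ν P.K k, ∀ j < k,
      UniqueUkOrbit F N P.K (j + 1) θ.εbg (Averaging.iter (avOfRecord F N P.K) (j + 1) (Uk F N P.K k θ.εbg V)))
    (hnestreg : ∀ k, k ≤ P.K → ∀ V ∈ domAltOfRecord F N θ.ν P.K k, ∀ i, i + 1 < k →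
      Averaging.iter (avOfRecord F N P.K) (i + 1) (Uk F N P.K k θ.εbg V) ∈ regSetOfRecord F N P.K i
        (betaInputOfRecord F N (TβOfRecord₁₃ F N) (chiβOfRecord₁₃ F N θ.toStage13Params) P.K (gOfRecord₁₃ F N θ.toStage13Params P) i)) :
    (leavesP w P).smallCouplings → (leavesP w P).smallFieldInductive :=
  thm3Member_stage13SepCoPH_of_regSets θ h hC P hχinv hχreg (integrable_betaInput_stage13_of_measurableUk θ.toStage13Params P hU) h11 hres huniq hnestreg

/-- **(v1.1) N09 AT `(w, P)`, LOCATED FORM, (I19) REPLACED BY (H-U)**: own leaf `b12` + the inputs above ⇒ `Dag.B12_main (leavesP w P)`.  CONDITIONAL; N09 NOT discharged.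
[cite: Balaban1987RG1, Lemma 4 (3.53) p.280, Thm 3 p.264 and (1.1)–(1.3) p.260; Balaban1985Variational, Thm 1 p.279] -/
theorem b12_main_stage13SepCoPH_of_leaf_of_regSets_of_measurableUk (θ : Stage13HParams F N) (h : θ.Provisos₁₃SepCoPH F N) {w : WorldP}
    (hC : w.C = (datumOfRecord₁₃SepCoPH F N θ h).C) (P : B12.RunParams) (h12 : (leavesP w P).b12)
    (hχinv : ∀ j < P.K, LiftInvariant (chiβOfRecord₁₃ F N θ.toStage13Params P.K (gOfRecord₁₃ F N θ.toStage13Params P) j))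
    (hU : ∀ k, k < P.K → Measurable (Uk F N P.K (k + 1) θ.ν.εreg))
    (hχreg : ∀ i, i + 1 < P.K → ∀ U, U ∉ regSetOfRecord F N P.K i
        (betaInputOfRecord F N (TβOfRecord₁₃ F N) (chiβOfRecord₁₃ F N θ.toStage13Params) P.K (gOfRecord₁₃ F N θ.toStage13Params P) i) →
      chiβOfRecord₁₃ F N θ.toStage13Params P.K (gOfRecord₁₃ F N θ.toStage13Params P) (i + 1) U = 0)
    (h11 : ∀ k, k ≤ P.K → ∀ V ∈ domAltOfRecord F N θ.ν P.K k, UkExists F N P.K k θ.εbg V ∧ UniqueUkOrbit F N P.K k θ.εbg V)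
    (hres : ∀ k, k ≤ P.K → HRestrict F N θ.εbg P.K k (domAltOfRecord F N θ.ν P.K k))
    (huniq : ∀ k, k ≤ P.K → ∀ V ∈ domAltOfRecord F N θ.ν P.K k, ∀ j < k,
      UniqueUkOrbit F N P.K (j + 1) θ.εbg (Averaging.iter (avOfRecord F N P.K) (j + 1) (Uk F N P.K k θ.εbg V)))
    (hnestreg : ∀ k, k ≤ P.K → ∀ V ∈ domAltOfRecord F N θ.ν P.K k, ∀ i, i + 1 < k →
      Averaging.iter (avOfRecord F N P.K) (i + 1) (Uk F N P.K k θ.εbg V) ∈ regSetOfRecord F N P.K i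
        (betaInputOfRecord F N (TβOfRecord₁₃ F N) (chiβOfRecord₁₃ F N θ.toStage13Params) P.K (gOfRecord₁₃ F N θ.toStage13Params P) i)) :
    Dag.B12_main (leavesP w P) :=
  b12_main_of_leaf_of_thm3Member h12 (thm3Member_stage13SepCoPH_of_regSets_of_measurableUk θ h hC P hχinv hU hχreg h11 hres huniq hnestreg)

/-- **(v1.1) THE `∀ P` FORM = N24's BINDER `h09T`, (I19) REPLACED BY (H-U).**  CONDITIONAL; N09 NOT discharged; K1⁷ NOT closed.
[cite: Balaban1987RG1, Thm 3 p.264, (1.1)–(1.3) p.260, (2.9)–(2.10) pp.266–267; Balaban1985Variational, Thm 1 (8)–(10) p.279] -/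
theorem thm3Member_forall_stage13SepCoPH_of_regSets_of_measurableUk (θ : Stage13HParams F N) (h : θ.Provisos₁₃SepCoPH F N) {w : WorldP}
    (hC : w.C = (datumOfRecord₁₃SepCoPH F N θ h).C)
    (hχinv : ∀ (P : B12.RunParams), ∀ j < P.K, LiftInvariant (chiβOfRecord₁₃ F N θ.toStage13Params P.K (gOfRecord₁₃ F N θ.toStage13Params P) j))
    (hU : ∀ (P : B12.RunParams) (k : ℕ), k < P.K → Measurable (Uk F N P.K (k + 1) θ.ν.εreg))
    (hχreg : ∀ (P : B12.RunParams) (i : ℕ), i + 1 < P.K → ∀ U, U ∉ regSetOfRecord F N P.K i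
        (betaInputOfRecord F N (TβOfRecord₁₃ F N) (chiβOfRecord₁₃ F N θ.toStage13Params) P.K (gOfRecord₁₃ F N θ.toStage13Params P) i) →
      chiβOfRecord₁₃ F N θ.toStage13Params P.K (gOfRecord₁₃ F N θ.toStage13Params P) (i + 1) U = 0)
    (h11 : ∀ (P : B12.RunParams) (k : ℕ), k ≤ P.K → ∀ V ∈ domAltOfRecord F N θ.ν P.K k, UkExists F N P.K k θ.εbg V ∧ UniqueUkOrbit F N P.K k θ.εbg V)
    (hres : ∀ (P : B12.RunParams) (k : ℕ), k ≤ P.K → HRestrict F N θ.εbg P.K k (domAltOfRecord F N θ.ν P.K k))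
    (huniq : ∀ (P : B12.RunParams) (k : ℕ), k ≤ P.K → ∀ V ∈ domAltOfRecord F N θ.ν P.K k, ∀ j < k,
      UniqueUkOrbit F N P.K (j + 1) θ.εbg (Averaging.iter (avOfRecord F N P.K) (j + 1) (Uk F N P.K k θ.εbg V)))
    (hnestreg : ∀ (P : B12.RunParams) (k : ℕ), k ≤ P.K → ∀ V ∈ domAltOfRecord F N θ.ν P.K k, ∀ i, i + 1 < k →
      Averaging.iter (avOfRecord F N P.K) (i + 1) (Uk F N P.K k θ.εbg V) ∈ regSetOfRecord F N P.K i
        (betaInputOfRecord F N (TβOfRecord₁₃ F N) (chiβOfRecord₁₃ F N θ.toStage13Params) P.K (gOfRecord₁₃ F N θ.toStage13Params P) i)) :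
    ∀ P : B12.RunParams, (leavesP w P).smallCouplings → (leavesP w P).smallFieldInductive :=
  fun P => thm3Member_stage13SepCoPH_of_regSets_of_measurableUk θ h hC P (hχinv P) (hU P) (hχreg P) (h11 P) (hres P) (huniq P) (hnestreg P)

end Measurable

/-! ## §5. (v1.2) (M1) FROM (M1′): the (2.9) cut-off is lift-invariant AS SOON AS the critical configuration `V^{(k)}(W) = M^k(U_{k+1}(W))` of (2.3) is
BLOCK-LIFT COVARIANT, `V^{(k)}(W^v) = (V^{(k)}(W))^{v∘blockOf}` — print's property of the gauge-fixed minimiser; a bare choice `Uk` has no such theorem -/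

section Covariant

open B12RTGaugeInvariance254 (liftTransf avg_gaugeAct_liftTransf)

/-- **(v1.2) LIFT-INVARIANCE OF `χ^{(2.9)}_k` FROM THE BLOCK-LIFT COVARIANCE OF THE CRITICAL CONFIGURATION** (`k < K`): if `V^{(k)}(W^v) = (V^{(k)}(W))^{v∘blockOf}` for every
coarse gauge transformation `v` of `T^{(k+1)}` and every `W`, then `χ^{(2.9)}_k(V^{v∘blockOf}) = χ^{(2.9)}_k(V)`: the averaging of record is covariant
(`B12RTGaugeInvariance254.avg_gaugeAct_liftTransf`: `(V^{v∘blockOf})‾ = V̄^v`), so every fluctuation variable `V^{(k)}(V̄)(b)⁻¹·V(b)` is CONJUGATED by `(v∘blockOf)(b₊)` and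
`dist1` is conjugation invariant (`GaugeGroup.dist1_conj`); the cut-off reads only the profile `b ↦ |V′(b) − 1|`.  (M1′) is a property of the MINIMISER SELECTION behind
`critCfgOfRecord` — automatic for print's axial-gauge minimiser ([I] (2.3) p.265, [B11] Thm 1), NOT derivable for the record's `Classical.choose` — DISPLAYED, never asserted.
[cite: Balaban1987RG1, (0.6) p.253, (2.1) p.265, (2.3) p.265, (2.9) p.266; Balaban1985Averaging, (11)–(13) p.19] -/
theorem liftInvariant_chiFix29OfRecord_of_critCfg_covariant (ν : Stage7Numerics) (ε₁ : ℝ) {K k : ℕ} (hk : k < K)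
    (hcov : ∀ (v : GaugeTransf (F.P K) (k + 1) (SU N)) (W : GaugeField (F.P K) (k + 1) (SU N)),
      critCfgOfRecord F N ν K k (gaugeAct v W) = gaugeAct (liftTransf v) (critCfgOfRecord F N ν K k W)) :
    LiftInvariant (chiFix29OfRecord F N ν ε₁ K k) := by
  have hj : k + 1 ≤ (F.P K).m + (F.P K).K := by simp only [T4Continuum.T4Family.P_K]; omega
  intro v V
  have hdev : ∀ b, fluctDevOfRecord F N ν K k (gaugeAct (liftTransf v) V) b = fluctDevOfRecord F N ν K k V b := by
    intro b
    rw [fluctDevOfRecord_apply, fluctDevOfRecord_apply, avg_gaugeAct_liftTransf hj, hcov]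
    set C := critCfgOfRecord F N ν K k ((avOfRecord F N K k).avg V) with hC
    set u := liftTransf v with hu
    show dist1 ((u b.src * C b * (u b.tgt)⁻¹)⁻¹ * (u b.src * V b * (u b.tgt)⁻¹)) = dist1 ((C b)⁻¹ * V b)
    have hconj : (u b.src * C b * (u b.tgt)⁻¹)⁻¹ * (u b.src * V b * (u b.tgt)⁻¹) = u b.tgt * ((C b)⁻¹ * V b) * (u b.tgt)⁻¹ := by group
    rw [hconj, GaugeGroup.dist1_conj]
  classical
  simp only [chiFix29OfRecord, hdev]

variable {F N}

/-- **(v1.2) (M1) ALONG A RUN OF A STAGE-13 PARAMETER FROM (M1′)**: block-lift covariance of `critCfgOfRecord θ₀.ν P.K k` at every step `k < K` gives `hχinv` of §2–§4 for the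
record's (2.9) cut-off `chiβOfRecord₁₃ θ₀` (coupling-blind). [cite: Balaban1987RG1, (2.3) p.265, (2.9) p.266] -/
theorem liftInvariant_chiβOfRecord₁₃_of_critCfg_covariant (θ₀ : Stage13Params F N) (P : B12.RunParams)
    (hcov : ∀ k, k < P.K → ∀ (v : GaugeTransf (F.P P.K) (k + 1) (SU N)) (W : GaugeField (F.P P.K) (k + 1) (SU N)),
      critCfgOfRecord F N θ₀.ν P.K k (gaugeAct v W) = gaugeAct (liftTransf v) (critCfgOfRecord F N θ₀.ν P.K k W)) :
    ∀ j, j < P.K → LiftInvariant (chiβOfRecord₁₃ F N θ₀ P.K (gOfRecord₁₃ F N θ₀ P) j) :=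
  fun j hj => liftInvariant_chiFix29OfRecord_of_critCfg_covariant F N θ₀.ν θ₀.ε₂₉ hj (hcov j hj)

/-- **★ (v1.2) THE THEOREM-3 MEMBER AT THE STAGE-13 v1.7 CONSTRUCTION, FULLY LOCATED ON THE SELECTION**: §4's form with (M1) supplied from (M1′).  Displayed, per run: (M1′)
`hcov` block-lift COVARIANCE of the critical configuration and (H-U) `hU` MEASURABILITY of the minimiser selection — the two properties of `Uk` behind `critCfgOfRecord`
that print's gauge-fixed measurable minimiser has and the record's bare choice lacks — (F7a) support ∕ (F7b) nesting in `regSetOfRecord`, and [B11] Thm 1 ×3 (N07).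
CONDITIONAL; nothing of Bałaban asserted; N09 NOT discharged. [cite: Balaban1987RG1, Thm 3 p.264, (1.1)–(1.3) p.260, (0.13) p.254, (0.19) p.255, (2.3) p.265, (2.9)–(2.10) pp.266–267; Balaban1985Variational, Thm 1 (8)–(10) p.279] -/
theorem thm3Member_stage13SepCoPH_of_regSets_of_covariant_of_measurableUk (θ : Stage13HParams F N) (h : θ.Provisos₁₃SepCoPH F N) {w : WorldP}
    (hC : w.C = (datumOfRecord₁₃SepCoPH F N θ h).C) (P : B12.RunParams)
    (hcov : ∀ k, k < P.K → ∀ (v : GaugeTransf (F.P P.K) (k + 1) (SU N)) (W : GaugeField (F.P P.K) (k + 1) (SU N)),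
      critCfgOfRecord F N θ.ν P.K k (gaugeAct v W) = gaugeAct (liftTransf v) (critCfgOfRecord F N θ.ν P.K k W))
    (hU : ∀ k, k < P.K → Measurable (Uk F N P.K (k + 1) θ.ν.εreg))
    (hχreg : ∀ i, i + 1 < P.K → ∀ U, U ∉ regSetOfRecord F N P.K i
        (betaInputOfRecord F N (TβOfRecord₁₃ F N) (chiβOfRecord₁₃ F N θ.toStage13Params) P.K (gOfRecord₁₃ F N θ.toStage13Params P) i) →
      chiβOfRecord₁₃ F N θ.toStage13Params P.K (gOfRecord₁₃ F N θ.toStage13Params P) (i + 1) U = 0)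
    (h11 : ∀ k, k ≤ P.K → ∀ V ∈ domAltOfRecord F N θ.ν P.K k, UkExists F N P.K k θ.εbg V ∧ UniqueUkOrbit F N P.K k θ.εbg V)
    (hres : ∀ k, k ≤ P.K → HRestrict F N θ.εbg P.K k (domAltOfRecord F N θ.ν P.K k))
    (huniq : ∀ k, k ≤ P.K → ∀ V ∈ domAltOfRecord F N θ.ν P.K k, ∀ j < k,
      UniqueUkOrbit F N P.K (j + 1) θ.εbg (Averaging.iter (avOfRecord F N P.K) (j + 1) (Uk F N P.K k θ.εbg V)))
    (hnestreg : ∀ k, k ≤ P.K → ∀ V ∈ domAltOfRecord F N θ.ν P.K k, ∀ i, i + 1 < k →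
      Averaging.iter (avOfRecord F N P.K) (i + 1) (Uk F N P.K k θ.εbg V) ∈ regSetOfRecord F N P.K i
        (betaInputOfRecord F N (TβOfRecord₁₃ F N) (chiβOfRecord₁₃ F N θ.toStage13Params) P.K (gOfRecord₁₃ F N θ.toStage13Params P) i)) :
    (leavesP w P).smallCouplings → (leavesP w P).smallFieldInductive :=
  thm3Member_stage13SepCoPH_of_regSets_of_measurableUk θ h hC P (liftInvariant_chiβOfRecord₁₃_of_critCfg_covariant θ.toStage13Params P hcov)
    hU hχreg h11 hres huniq hnestreg

/-- **(v1.2) N09 AT `(w, P)`, FULLY LOCATED ON THE SELECTION**: own leaf `b12` + the inputs above ⇒ `Dag.B12_main (leavesP w P)`.  CONDITIONAL; N09 NOT discharged.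
[cite: Balaban1987RG1, Lemma 4 (3.53) p.280, Thm 3 p.264 and (1.1)–(1.3) p.260; Balaban1985Variational, Thm 1 p.279] -/
theorem b12_main_stage13SepCoPH_of_leaf_of_regSets_of_covariant_of_measurableUk (θ : Stage13HParams F N) (h : θ.Provisos₁₃SepCoPH F N) {w : WorldP}
    (hC : w.C = (datumOfRecord₁₃SepCoPH F N θ h).C) (P : B12.RunParams) (h12 : (leavesP w P).b12)
    (hcov : ∀ k, k < P.K → ∀ (v : GaugeTransf (F.P P.K) (k + 1) (SU N)) (W : GaugeField (F.P P.K) (k + 1) (SU N)),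
      critCfgOfRecord F N θ.ν P.K k (gaugeAct v W) = gaugeAct (liftTransf v) (critCfgOfRecord F N θ.ν P.K k W))
    (hU : ∀ k, k < P.K → Measurable (Uk F N P.K (k + 1) θ.ν.εreg))
    (hχreg : ∀ i, i + 1 < P.K → ∀ U, U ∉ regSetOfRecord F N P.K i
        (betaInputOfRecord F N (TβOfRecord₁₃ F N) (chiβOfRecord₁₃ F N θ.toStage13Params) P.K (gOfRecord₁₃ F N θ.toStage13Params P) i) →
      chiβOfRecord₁₃ F N θ.toStage13Params P.K (gOfRecord₁₃ F N θ.toStage13Params P) (i + 1) U = 0)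
    (h11 : ∀ k, k ≤ P.K → ∀ V ∈ domAltOfRecord F N θ.ν P.K k, UkExists F N P.K k θ.εbg V ∧ UniqueUkOrbit F N P.K k θ.εbg V)
    (hres : ∀ k, k ≤ P.K → HRestrict F N θ.εbg P.K k (domAltOfRecord F N θ.ν P.K k))
    (huniq : ∀ k, k ≤ P.K → ∀ V ∈ domAltOfRecord F N θ.ν P.K k, ∀ j < k,
      UniqueUkOrbit F N P.K (j + 1) θ.εbg (Averaging.iter (avOfRecord F N P.K) (j + 1) (Uk F N P.K k θ.εbg V)))
    (hnestreg : ∀ k, k ≤ P.K → ∀ V ∈ domAltOfRecord F N θ.ν P.K k, ∀ i, i + 1 < k →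
      Averaging.iter (avOfRecord F N P.K) (i + 1) (Uk F N P.K k θ.εbg V) ∈ regSetOfRecord F N P.K i
        (betaInputOfRecord F N (TβOfRecord₁₃ F N) (chiβOfRecord₁₃ F N θ.toStage13Params) P.K (gOfRecord₁₃ F N θ.toStage13Params P) i)) :
    Dag.B12_main (leavesP w P) :=
  b12_main_of_leaf_of_thm3Member h12 (thm3Member_stage13SepCoPH_of_regSets_of_covariant_of_measurableUk θ h hC P hcov hU hχreg h11 hres huniq hnestreg)

/-- **★ (v1.2) THE `∀ P` FORM = N24's BINDER `h09T`, FULLY LOCATED ON THE SELECTION** ((M1′) covariance + (H-U) measurability of `Uk`; (F7a)∕(F7b); [B11] ×3).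
CONDITIONAL; N09 NOT discharged; K1⁷ NOT closed. [cite: Balaban1987RG1, Thm 3 p.264, (1.1)–(1.3) p.260, (2.3) p.265, (2.9)–(2.10) pp.266–267; Balaban1985Variational, Thm 1 (8)–(10) p.279] -/
theorem thm3Member_forall_stage13SepCoPH_of_regSets_of_covariant_of_measurableUk (θ : Stage13HParams F N) (h : θ.Provisos₁₃SepCoPH F N) {w : WorldP}
    (hC : w.C = (datumOfRecord₁₃SepCoPH F N θ h).C)
    (hcov : ∀ (P : B12.RunParams) (k : ℕ), k < P.K → ∀ (v : GaugeTransf (F.P P.K) (k + 1) (SU N)) (W : GaugeField (F.P P.K) (k + 1) (SU N)),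
      critCfgOfRecord F N θ.ν P.K k (gaugeAct v W) = gaugeAct (liftTransf v) (critCfgOfRecord F N θ.ν P.K k W))
    (hU : ∀ (P : B12.RunParams) (k : ℕ), k < P.K → Measurable (Uk F N P.K (k + 1) θ.ν.εreg))
    (hχreg : ∀ (P : B12.RunParams) (i : ℕ), i + 1 < P.K → ∀ U, U ∉ regSetOfRecord F N P.K i
        (betaInputOfRecord F N (TβOfRecord₁₃ F N) (chiβOfRecord₁₃ F N θ.toStage13Params) P.K (gOfRecord₁₃ F N θ.toStage13Params P) i) →
      chiβOfRecord₁₃ F N θ.toStage13Params P.K (gOfRecord₁₃ F N θ.toStage13Params P) (i + 1) U = 0)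
    (h11 : ∀ (P : B12.RunParams) (k : ℕ), k ≤ P.K → ∀ V ∈ domAltOfRecord F N θ.ν P.K k, UkExists F N P.K k θ.εbg V ∧ UniqueUkOrbit F N P.K k θ.εbg V)
    (hres : ∀ (P : B12.RunParams) (k : ℕ), k ≤ P.K → HRestrict F N θ.εbg P.K k (domAltOfRecord F N θ.ν P.K k))
    (huniq : ∀ (P : B12.RunParams) (k : ℕ), k ≤ P.K → ∀ V ∈ domAltOfRecord F N θ.ν P.K k, ∀ j < k,
      UniqueUkOrbit F N P.K (j + 1) θ.εbg (Averaging.iter (avOfRecord F N P.K) (j + 1) (Uk F N P.K k θ.εbg V)))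
    (hnestreg : ∀ (P : B12.RunParams) (k : ℕ), k ≤ P.K → ∀ V ∈ domAltOfRecord F N θ.ν P.K k, ∀ i, i + 1 < k →
      Averaging.iter (avOfRecord F N P.K) (i + 1) (Uk F N P.K k θ.εbg V) ∈ regSetOfRecord F N P.K i
        (betaInputOfRecord F N (TβOfRecord₁₃ F N) (chiβOfRecord₁₃ F N θ.toStage13Params) P.K (gOfRecord₁₃ F N θ.toStage13Params P) i)) :
    ∀ P : B12.RunParams, (leavesP w P).smallCouplings → (leavesP w P).smallFieldInductive :=
  fun P => thm3Member_stage13SepCoPH_of_regSets_of_covariant_of_measurableUk θ h hC P (hcov P) (hU P) (hχreg P) (h11 P) (hres P) (huniq P) (hnestreg P)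

end Covariant

end Literature.MathematicalPhysics.QuantumFieldTheory.Balaban1983to89.B12NodeKnitRecord13SepCoPH

end
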